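import Summits.RiemannHypothesis.RiemannHypothesis.Theorems.WeilFormatCColumnEven
import Summits.RiemannHypothesis.RiemannHypothesis.Theorems.WeilFormatCTailMajorant
import Summits.RiemannHypothesis.RiemannHypothesis.Theorems.WeilFormatCOffDiagHSBound
import Summits.RiemannHypothesis.RiemannHypothesis.Theorems.WeilFormatCSoundness
import HarnessLib

/-!
# Format C, L-C3b order 1 (even sector): the TAIL majorant `U₂` — hypothesis `hU₂` of the soundness theorem, explicit

Route context: Fourier–Galerkin / Schur-complement certificates of Weil positivity on a window ("format C";
cell memo `run/shared/lean/pub/rh-explicit/rh-explicit-weil-10/FORMATC-DESIGN.md` §4.6 / §9.5; supporting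
stmt-RiemannHypothesis-0098; seat rh-explicit-weil-10).  From the order-1 column structure
`WeilFormatC.abs_evenKernel_col_sub_le` (`b_m(i) = (−1)^{i+m}g_m/(4m) + r_m(i)`, `|r_m(i)| ≤ κ⁺(i)/m²`, `2i ≤ m`) and the
algebraic majorant `WeilFormatC.tailMajorant` (one structured direction `v(i) = (−1)^i`), for EVERY truncation `N`:

* `even_tail_majorant` — for `a > 0`, block size `B` with `2B ≤ B₃`, `2 ≤ B₃`, any weight `d` with `0 < d₀ ≤ d_m` on
  `m ≥ B₃`, any `θ > 0` and every real block vector `x`: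
  `Σ_{m∈Ico B₃ N} (Σ_{i<B} M⁺(i,m) x_i)²/d_m ≤ (1+θ)·Φ²/(d₀(B₃−1))·(Σ_i (−1)^i x_i)² + (1+θ⁻¹)·B/(d₀ B₃²(B₃−1))·Σ_i κ⁺(i)² x_i²`
  with `Φ = (1 + (4/π)ΛΣ)/4 ≥ |g_m|/4`, `ΛΣ = Σ_{k∈weilPrimeIndex a} Λ(k)k^{−1/2}` — the right side is `xᵀU₂x` for the
  explicit matrix `U₂ = (1+θ)Φ²/(d₀(B₃−1))·vvᵀ + (1+θ⁻¹)B/(d₀B₃²(B₃−1))·diag(κ⁺²)` (`even_tail_majorant_matrix`, the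
  `hU₂` shape of `sum_range_mul_mul_nonneg_of_certificate_sum_split`).

Tail sums used: `Σ_{m≥B₃} 1/m² ≤ 1/(B₃−1)` (`sum_Ioc_inv_sq_le`) and `1/m⁴ ≤ 1/(B₃²m²)`.  With `d = d̂⁺` of
`WeilFormatCFarAssembly.lean` (monotone, `d₀ = d̂⁺(B₃)`), this leaves only the exactly ENCLOSED columns `B ≤ m < B₃`
(`U₁`, data) and the block certificate for a kernel even-sector rung.  Standard axioms; no definitions; no RH claim.
-/

set_option autoImplicit false
-- `Summit.RiemannHypothesis.RiemannHypothesis.…` is the layout-mandated namespace (summit = problem name).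
set_option linter.dupNamespace false

noncomputable section

open Complex Finset Matrix
open scoped Real BigOperators ArithmeticFunction.vonMangoldt

namespace Summit.RiemannHypothesis.RiemannHypothesis.Theorems.WeilFormatC

open Literature.NumberTheory.LFunctions Literature.NumberTheory.LFunctions.Yoshida1992
open Literature.Analysis.SpecialFunctions

variable {a : ℝ}

/-! ## Tail sums -/

/-- `Σ_{m∈Ico B₃ N} 1/m² ≤ 1/(B₃ − 1)` for `2 ≤ B₃`. -/
theorem sum_Ico_inv_sq_le {B₃ : ℕ} (hB : 2 ≤ B₃) (N : ℕ) :
    ∑ m ∈ Finset.Ico B₃ N, 1 / ((m : ℝ) ^ 2) ≤ 1 / ((B₃ - 1 : ℕ) : ℝ) := by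
  have hsub : Finset.Ico B₃ N ⊆ Finset.Ioc (B₃ - 1) N := by
    intro m hm
    rw [Finset.mem_Ico] at hm
    rw [Finset.mem_Ioc]
    omega
  refine (Finset.sum_le_sum_of_subset_of_nonneg hsub fun m _ _ ↦ by positivity).trans ?_
  exact sum_Ioc_inv_sq_le (by omega)

/-- `Σ_{m∈Ico B₃ N} 1/m⁴ ≤ 1/(B₃²(B₃ − 1))` for `2 ≤ B₃` (crude: `1/m⁴ ≤ 1/(B₃² m²)`). -/
theorem sum_Ico_inv_pow_four_le {B₃ : ℕ} (hB : 2 ≤ B₃) (N : ℕ) :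
    ∑ m ∈ Finset.Ico B₃ N, 1 / ((m : ℝ) ^ 4) ≤ 1 / (((B₃ : ℝ) ^ 2) * ((B₃ - 1 : ℕ) : ℝ)) := by
  have hB0 : (0 : ℝ) < B₃ := by exact_mod_cast (show 0 < B₃ by omega)
  have hterm : ∀ m ∈ Finset.Ico B₃ N, 1 / ((m : ℝ) ^ 4) ≤ 1 / (B₃ : ℝ) ^ 2 * (1 / (m : ℝ) ^ 2) := by
    intro m hm
    have hm : (B₃ : ℝ) ≤ m := by exact_mod_cast (Finset.mem_Ico.mp hm).1
    have hm0 : (0 : ℝ) < m := lt_of_lt_of_le hB0 hm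
    rw [div_mul_div_comm, one_mul, show (m : ℝ) ^ 4 = (m : ℝ) ^ 2 * (m : ℝ) ^ 2 by ring]
    exact one_div_le_one_div_of_le (by positivity)
      (mul_le_mul_of_nonneg_right (pow_le_pow_left₀ hB0.le hm 2) (by positivity))
  refine (Finset.sum_le_sum hterm).trans ?_
  rw [← Finset.mul_sum]
  have h := sum_Ico_inv_sq_le hB N
  calc 1 / (B₃ : ℝ) ^ 2 * ∑ m ∈ Finset.Ico B₃ N, 1 / (m : ℝ) ^ 2
      ≤ 1 / (B₃ : ℝ) ^ 2 * (1 / ((B₃ - 1 : ℕ) : ℝ)) := mul_le_mul_of_nonneg_left h (by positivity)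
    _ = 1 / (((B₃ : ℝ) ^ 2) * ((B₃ - 1 : ℕ) : ℝ)) := by rw [one_div_mul_one_div]

/-- `|g_m| ≤ 1 + (4/π)ΛΣ` for `g_m = 1 + (4/π)Σ_k (Λ_k/√k) sin(ω_m log k)`. -/
theorem abs_gm_le (a : ℝ) (m : ℤ) :
    |1 + 4 / π * ∑ k ∈ weilPrimeIndex a, (Λ k : ℝ) / Real.sqrt k * Real.sin (freq a m * Real.log k)|
      ≤ 1 + 4 / π * ∑ k ∈ weilPrimeIndex a, (Λ k : ℝ) / Real.sqrt k := by
  have hs : |∑ k ∈ weilPrimeIndex a, (Λ k : ℝ) / Real.sqrt k * Real.sin (freq a m * Real.log k)|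
      ≤ ∑ k ∈ weilPrimeIndex a, (Λ k : ℝ) / Real.sqrt k := by
    refine (Finset.abs_sum_le_sum_abs _ _).trans (Finset.sum_le_sum fun k _ ↦ ?_)
    have hw : 0 ≤ (Λ k : ℝ) / Real.sqrt k := div_nonneg ArithmeticFunction.vonMangoldt_nonneg (Real.sqrt_nonneg _)
    rw [abs_mul, abs_of_nonneg hw]
    exact (mul_le_mul_of_nonneg_left (Real.abs_sin_le_one _) hw).trans (le_of_eq (mul_one _))
  have h4 : (0 : ℝ) ≤ 4 / π := by positivity
  calc |1 + 4 / π * ∑ k ∈ weilPrimeIndex a, (Λ k : ℝ) / Real.sqrt k * Real.sin (freq a m * Real.log k)|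
      ≤ |(1 : ℝ)| + |4 / π * ∑ k ∈ weilPrimeIndex a, (Λ k : ℝ) / Real.sqrt k * Real.sin (freq a m * Real.log k)| :=
        abs_add_le _ _
    _ ≤ 1 + 4 / π * ∑ k ∈ weilPrimeIndex a, (Λ k : ℝ) / Real.sqrt k := by
        rw [abs_one, abs_mul, abs_of_nonneg h4]
        exact add_le_add le_rfl (mul_le_mul_of_nonneg_left hs h4)

/-! ## The even tail majorant -/

section Tail

/-- **Even tail majorant (order 1).**  See the module docstring.  The kernel is weil-2's even SectorSplit kernel of
`gramCoeff a` in its `if`-form (as in `weilPositivityOn_of_formatC_certificates`). -/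
theorem even_tail_majorant (ha : 0 < a) {B B₃ : ℕ} (hBB : 2 * B ≤ B₃) (hB₃ : 2 ≤ B₃)
    (d : ℕ → ℝ) {d₀ : ℝ} (hd₀ : 0 < d₀) (hd : ∀ m, B₃ ≤ m → d₀ ≤ d m) {θ : ℝ} (hθ : 0 < θ)
    (N : ℕ) (x : Fin B → ℝ) :
    ∑ m ∈ Finset.Ico B₃ N, (∑ i : Fin B,
        (if (i : ℕ) = 0 then gramCoeff a 0 m else if m = 0 then gramCoeff a i 0
          else (gramCoeff a i m + gramCoeff a i (-(m : ℤ))) / 2) * x i) ^ 2 / d m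
      ≤ (1 + θ) * ((1 + 4 / π * ∑ k ∈ weilPrimeIndex a, (Λ k : ℝ) / Real.sqrt k) / 4) ^ 2
            / (d₀ * ((B₃ - 1 : ℕ) : ℝ)) * (∑ i : Fin B, (-1 : ℝ) ^ (i : ℕ) * x i) ^ 2
        + (1 + θ⁻¹) * (B / (d₀ * ((B₃ : ℝ) ^ 2 * ((B₃ - 1 : ℕ) : ℝ))))
            * ∑ i : Fin B, ((Real.exp (a / 2) - Real.exp (-(a / 2))) ^ 2 * a / π ^ 2
                + 2 * (i : ℕ) * (∑ k ∈ weilPrimeIndex a, (Λ k : ℝ) / Real.sqrt k) / π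
                + (((i : ℕ) : ℝ) / 2 + 8 * a * (1 + weilArchDensity (2 * a)) / (3 * π ^ 2))) ^ 2 * x i ^ 2 := by
  set T := Finset.Ico B₃ N with hT
  set LS := ∑ k ∈ weilPrimeIndex a, (Λ k : ℝ) / Real.sqrt k with hLS
  set Φ : ℝ := (1 + 4 / π * LS) / 4 with hΦ
  -- the structured decomposition
  set bcol : ℕ → Fin B → ℝ := fun m i ↦
    (if (i : ℕ) = 0 then gramCoeff a 0 m else if m = 0 then gramCoeff a i 0
      else (gramCoeff a i m + gramCoeff a i (-(m : ℤ))) / 2) with hbcol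
  set φ : Fin 1 → ℕ → ℝ := fun _ m ↦ (-1 : ℝ) ^ m *
    (1 + 4 / π * ∑ k ∈ weilPrimeIndex a, (Λ k : ℝ) / Real.sqrt k * Real.sin (freq a m * Real.log k)) / (4 * m)
    with hφ
  set v : Fin 1 → Fin B → ℝ := fun _ i ↦ (-1 : ℝ) ^ (i : ℕ) with hv
  set r : ℕ → Fin B → ℝ := fun m i ↦ bcol m i - ∑ e : Fin 1, v e i * φ e m with hr
  set κ : Fin B → ℝ := fun i ↦ (Real.exp (a / 2) - Real.exp (-(a / 2))) ^ 2 * a / π ^ 2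
      + 2 * (i : ℕ) * LS / π + (((i : ℕ) : ℝ) / 2 + 8 * a * (1 + weilArchDensity (2 * a)) / (3 * π ^ 2)) with hκ
  have hTm : ∀ m ∈ T, B₃ ≤ m := fun m hm ↦ (Finset.mem_Ico.mp hm).1
  have hw : ∀ m ∈ T, 0 ≤ 1 / d m := fun m hm ↦ by
    have := hd m (hTm m hm); have : 0 < d m := lt_of_lt_of_le hd₀ this; positivity
  have hb : ∀ m ∈ T, ∀ i, bcol m i = (∑ e : Fin 1, v e i * φ e m) + r m i := fun m _ i ↦ by
    simp only [hr]; ring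
  have hrb : ∀ m ∈ T, ∀ i : Fin B, |r m i| ≤ κ i * (1 / (m : ℝ) ^ 2) := by
    intro m hm i
    have hmB := hTm m hm
    have hm1 : 1 ≤ m := by omega
    have h2i : 2 * (i : ℕ) ≤ m := by have := i.isLt; omega
    have h := abs_evenKernel_col_sub_le ha hm1 h2i
    have e : r m i = bcol m i - (-1 : ℝ) ^ (((i : ℕ) : ℤ) + m) *
        (1 + 4 / π * ∑ k ∈ weilPrimeIndex a, (Λ k : ℝ) / Real.sqrt k * Real.sin (freq a m * Real.log k))
          / (4 * m) := by
      simp only [hr, hv, hφ, Finset.univ_unique, Fin.default_eq_zero, Finset.sum_singleton]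
      rw [show (((i : ℕ) : ℤ) + (m : ℤ)) = (((i : ℕ) + m : ℕ) : ℤ) by push_cast; ring, zpow_natCast, pow_add]
      ring
    rw [e, hbcol]
    refine h.trans (le_of_eq ?_)
    simp only [hκ, hLS]
    ring
  have hmaj := tailMajorant T bcol r v φ (fun m ↦ 1 / d m) (fun m ↦ 1 / (m : ℝ) ^ 2) κ x hθ hw hb hrb
  -- simplify the `Fin 1` sums and the weights
  simp only [Finset.univ_unique, Fin.default_eq_zero, Finset.sum_singleton, Fintype.card_fin] at hmaj
  -- left side: `(1/d) · c² = c²/d`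
  have hlhs : ∑ m ∈ T, (∑ i : Fin B, bcol m i * x i) ^ 2 / d m = ∑ m ∈ T, 1 / d m * (∑ i : Fin B, bcol m i * x i) ^ 2 :=
    Finset.sum_congr rfl fun m _ ↦ by ring
  rw [hlhs]
  refine hmaj.trans ?_
  -- bound the two tail sums
  have hF : ∑ m ∈ T, 1 / d m * φ 0 m * φ 0 m ≤ Φ ^ 2 / (d₀ * ((B₃ - 1 : ℕ) : ℝ)) := by
    have hterm : ∀ m ∈ T, 1 / d m * φ 0 m * φ 0 m ≤ Φ ^ 2 / d₀ * (1 / (m : ℝ) ^ 2) := by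
      intro m hm
      have hdm := hd m (hTm m hm)
      have hdm0 : 0 < d m := lt_of_lt_of_le hd₀ hdm
      have hm0 : (0 : ℝ) < m := by exact_mod_cast (show 0 < m by have := hTm m hm; omega)
      have hg := abs_gm_le a m
      rw [← hLS] at hg
      have hφabs : |φ 0 m| ≤ Φ / m := by
        simp only [hφ]
        rw [abs_div, abs_mul, abs_of_pos (by positivity : (0 : ℝ) < 4 * m)]
        have h1 : |(-1 : ℝ) ^ m| = 1 := by rw [abs_pow, abs_neg, abs_one, one_pow]
        rw [h1, one_mul, hΦ]
        rw [div_le_div_iff₀ (by positivity) hm0]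
        nlinarith [hg, hm0]
      have hsq : φ 0 m * φ 0 m ≤ (Φ / m) ^ 2 := by
        have := sq_abs (φ 0 m)
        nlinarith [hφabs, abs_nonneg (φ 0 m), sq_nonneg (|φ 0 m| - Φ / m)]
      have hΦ0 : 0 ≤ Φ := by
        simp only [hΦ, hLS]
        have : 0 ≤ ∑ k ∈ weilPrimeIndex a, (Λ k : ℝ) / Real.sqrt k :=
          Finset.sum_nonneg fun k _ ↦ div_nonneg ArithmeticFunction.vonMangoldt_nonneg (Real.sqrt_nonneg _)
        positivity
      calc 1 / d m * φ 0 m * φ 0 m = 1 / d m * (φ 0 m * φ 0 m) := by ring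
        _ ≤ 1 / d₀ * (Φ / m) ^ 2 := by
            refine mul_le_mul (one_div_le_one_div_of_le hd₀ hdm) hsq
              (mul_self_nonneg _) (by positivity)
        _ = Φ ^ 2 / d₀ * (1 / (m : ℝ) ^ 2) := by
            field_simp
    refine (Finset.sum_le_sum hterm).trans ?_
    rw [← Finset.mul_sum]
    have hΦ2 : 0 ≤ Φ ^ 2 / d₀ := by positivity
    calc Φ ^ 2 / d₀ * ∑ m ∈ T, 1 / (m : ℝ) ^ 2 ≤ Φ ^ 2 / d₀ * (1 / ((B₃ - 1 : ℕ) : ℝ)) :=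
          mul_le_mul_of_nonneg_left (sum_Ico_inv_sq_le hB₃ N) hΦ2
      _ = Φ ^ 2 / (d₀ * ((B₃ - 1 : ℕ) : ℝ)) := by rw [div_mul_div_comm, mul_one]
  have hG : ∑ m ∈ T, 1 / d m * (1 / (m : ℝ) ^ 2) ^ 2 ≤ 1 / (d₀ * ((B₃ : ℝ) ^ 2 * ((B₃ - 1 : ℕ) : ℝ))) := by
    have hterm : ∀ m ∈ T, 1 / d m * (1 / (m : ℝ) ^ 2) ^ 2 ≤ 1 / d₀ * (1 / (m : ℝ) ^ 4) := by
      intro m hm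
      have hdm := hd m (hTm m hm)
      have e : (1 / (m : ℝ) ^ 2) ^ 2 = 1 / (m : ℝ) ^ 4 := by rw [_root_.one_div_pow, ← pow_mul]
      rw [e]
      exact mul_le_mul_of_nonneg_right (one_div_le_one_div_of_le hd₀ hdm) (by positivity)
    refine (Finset.sum_le_sum hterm).trans ?_
    rw [← Finset.mul_sum]
    calc 1 / d₀ * ∑ m ∈ T, 1 / (m : ℝ) ^ 4 ≤ 1 / d₀ * (1 / (((B₃ : ℝ) ^ 2) * ((B₃ - 1 : ℕ) : ℝ))) :=
          mul_le_mul_of_nonneg_left (sum_Ico_inv_pow_four_le hB₃ N) (by positivity)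
      _ = 1 / (d₀ * ((B₃ : ℝ) ^ 2 * ((B₃ - 1 : ℕ) : ℝ))) := by rw [one_div_mul_one_div]
  -- assemble
  have hsq0 : 0 ≤ (∑ i : Fin B, v 0 i * x i) * (∑ i : Fin B, v 0 i * x i) := mul_self_nonneg _
  have hρ0 : 0 ≤ (B : ℝ) * ∑ i : Fin B, κ i ^ 2 * x i ^ 2 := by
    have : 0 ≤ ∑ i : Fin B, κ i ^ 2 * x i ^ 2 := Finset.sum_nonneg fun i _ ↦ by positivity
    positivity
  have h1 : (1 + θ) * ((∑ m ∈ T, 1 / d m * φ 0 m * φ 0 m) * ((∑ i : Fin B, v 0 i * x i) * (∑ i : Fin B, v 0 i * x i)))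
      ≤ (1 + θ) * (Φ ^ 2 / (d₀ * ((B₃ - 1 : ℕ) : ℝ)) * ((∑ i : Fin B, v 0 i * x i) * (∑ i : Fin B, v 0 i * x i))) :=
    mul_le_mul_of_nonneg_left (mul_le_mul_of_nonneg_right hF hsq0) (by positivity)
  have h2 : (1 + θ⁻¹) * (∑ m ∈ T, 1 / d m * (1 / (m : ℝ) ^ 2) ^ 2) * ((B : ℝ) * ∑ i : Fin B, κ i ^ 2 * x i ^ 2)
      ≤ (1 + θ⁻¹) * (1 / (d₀ * ((B₃ : ℝ) ^ 2 * ((B₃ - 1 : ℕ) : ℝ)))) * ((B : ℝ) * ∑ i : Fin B, κ i ^ 2 * x i ^ 2) := by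
    have hθ1 : 0 ≤ 1 + θ⁻¹ := by positivity
    exact mul_le_mul_of_nonneg_right (mul_le_mul_of_nonneg_left hG hθ1) hρ0
  refine (add_le_add h1 h2).trans (le_of_eq ?_)
  simp only [hv, hκ, hΦ]
  rw [← sq]
  ring

/-- The explicit tail matrix `U₂ = (1+θ)F⁺·vvᵀ + (1+θ⁻¹)G⁺B·diag(κ⁺²)` has quadratic form equal to the right side of
`even_tail_majorant`; hence **`hU₂` of `sum_range_mul_mul_nonneg_of_certificate_sum_split`** for the even sector:
`Σ_{m∈Ico B₃ N} (Σ_i M⁺(i,m) x_i)²/d_m ≤ xᵀU₂x` for every `N`, `x`. -/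
theorem even_tail_majorant_matrix (ha : 0 < a) {B B₃ : ℕ} (hBB : 2 * B ≤ B₃) (hB₃ : 2 ≤ B₃)
    (d : ℕ → ℝ) {d₀ : ℝ} (hd₀ : 0 < d₀) (hd : ∀ m, B₃ ≤ m → d₀ ≤ d m) {θ : ℝ} (hθ : 0 < θ)
    (N : ℕ) (x : Fin B → ℝ) :
    ∑ m ∈ Finset.Ico B₃ N, (∑ i : Fin B,
        (if (i : ℕ) = 0 then gramCoeff a 0 m else if m = 0 then gramCoeff a i 0
          else (gramCoeff a i m + gramCoeff a i (-(m : ℤ))) / 2) * x i) ^ 2 / d m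
      ≤ x ⬝ᵥ (Matrix.of fun i j : Fin B ↦
          (1 + θ) * ((1 + 4 / π * ∑ k ∈ weilPrimeIndex a, (Λ k : ℝ) / Real.sqrt k) / 4) ^ 2
              / (d₀ * ((B₃ - 1 : ℕ) : ℝ)) * ((-1 : ℝ) ^ (i : ℕ) * (-1 : ℝ) ^ (j : ℕ))
            + (if i = j then (1 + θ⁻¹) * (B / (d₀ * ((B₃ : ℝ) ^ 2 * ((B₃ - 1 : ℕ) : ℝ))))
                * ((Real.exp (a / 2) - Real.exp (-(a / 2))) ^ 2 * a / π ^ 2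
                  + 2 * (i : ℕ) * (∑ k ∈ weilPrimeIndex a, (Λ k : ℝ) / Real.sqrt k) / π
                  + (((i : ℕ) : ℝ) / 2 + 8 * a * (1 + weilArchDensity (2 * a)) / (3 * π ^ 2))) ^ 2 else 0)) *ᵥ x := by
  refine (even_tail_majorant ha hBB hB₃ d hd₀ hd hθ N x).trans (le_of_eq ?_)
  rw [dotProduct_mulVec_eq_sum_sum]
  simp only [Matrix.of_apply, mul_add, Finset.sum_add_distrib, mul_ite, mul_zero, Finset.sum_ite_eq,
    Finset.mem_univ, if_true]
  congr 1
  · have hsq : (∑ i : Fin B, (-1 : ℝ) ^ (i : ℕ) * x i) ^ 2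
        = ∑ i : Fin B, ∑ j : Fin B, ((-1 : ℝ) ^ (i : ℕ) * x i) * ((-1 : ℝ) ^ (j : ℕ) * x j) := by
      rw [sq, Finset.sum_mul_sum]
    rw [hsq, Finset.mul_sum]
    refine Finset.sum_congr rfl fun i _ ↦ ?_
    rw [Finset.mul_sum]
    refine Finset.sum_congr rfl fun j _ ↦ by ring
  · rw [Finset.mul_sum]
    refine Finset.sum_congr rfl fun i _ ↦ by ring

end Tail

end Summit.RiemannHypothesis.RiemannHypothesis.Theorems.WeilFormatC

end
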